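import Mathlib.Algebra.Order.Floor.Defs
import Mathlib.Data.Rat.Floor
import Literature.Analysis.FluidPDE.CompressibleEulerImplosionSonicSeries
import HarnessLib

/-!
# Buckmaster–Cao-Labora–Gómez-Serrano at `γ = 5/3`: a sharp restarted majorant for the sonic series

Companion of `CompressibleEulerImplosionSonicSeries` (the recursions (2.9)–(2.10) for the ordinary Taylor
coefficients `wₙ(r)`, `zₙ(r)` of the analytic branch through `P_s`). The Catalan-majorant estimate of
`CompressibleEulerImplosionSonicAnalytic` (Prop. 2.3 of the paper) bounds all weights `(n + 1 − j)` of the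
convolutions `Σ D_{W,j}(n+1−j)w_{n+1−j}`, `Σ D_{Z,j}(m+1−j)z_{m+1−j}` by `n + 2`, which loses the radius of
convergence by orders of magnitude. For the certified uses of the branch (clause (e) of the cavity tube of the
pinned profile: radius `≥ 1/10` with majorant `10^m`, against a true radius `≈ 0.12`) one needs the SHARP steps:

* `abs_w_succ_succ_sharp`, `abs_z_succ_succ_sharp` — (2.9) and (2.10) solved for `w_{n+2}`, `z_{n+2}` and
  estimated termwise with their exact weights, the linear terms `N_{W,W}(P_s) w_{n+1} + N_{W,Z}(P_s) z_{n+1}`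
  and `coefW · w_{n+2}` kept separate;
* the integer RESTARTED SCALAR MAJORANT in the units `10^j/2^P` (`stepA`, `stepB`, `majPair`): given
  `|w_j| ≤ Â_j 10^j/2^P`, `|z_j| ≤ B̂_j 10^j/2^P` for `j < m` and rational window constants
  (`D_{W,0} ≥ dlo`, `|N_{W,W}| ≤ nww`, `|N_{W,Z}| ≤ nwz`, `|coefW| ≤ cw`, `|slopeZ(m)| ≥ dz1 (m − kk)`), it returns
  natural numbers `Â_m`, `B̂_m` with the same property (`abs_w_le_stepA`, `abs_z_le_stepB`), the convolutions being
  computed in linear time on lists (`dotN`, `zipN`, `mulIdx`); `abs_le_majPair` iterates.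

No facts, no axioms. [cite: BuckmasterCaolaboraGomezserrano2025, Prop. 2.2, Prop. 2.3, eqs. (2.9)–(2.11)]
-/

noncomputable section

open Finset

namespace Literature.Analysis.FluidPDE

namespace BuckmasterCaolaboraGomezserrano2025

namespace Monatomic

namespace SonicSeries

variable {r : ℝ}

/-! ### The sharp steps -/

/-- Peeling the extreme terms of a Cauchy coefficient of order `n + 1`. [folklore] -/
theorem cauchy_succ' (f g : ℕ → ℝ) (n : ℕ) :
    cauchy f g (n + 1) = f 0 * g (n + 1) + ∑ k ∈ range n, f (k + 1) * g (n - k) + f (n + 1) * g 0 := by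
  unfold cauchy
  rw [sum_range_succ, sum_range_succ' (fun k => f k * g (n + 1 - k))]
  have h1 : ∀ k ∈ range n, f (k + 1) * g (n + 1 - (k + 1)) = f (k + 1) * g (n - k) := by
    intro k hk
    congr 2
    omega
  rw [sum_congr rfl h1]
  simp only [Nat.sub_zero, Nat.sub_self]
  ring

/-- The linear part of `N_{W,n+1}` at `P_s`: `nWc(n+1) = N_{W,W} w_{n+1} + N_{W,Z} z_{n+1} + (indices 1 … n)`.
[cite: BuckmasterCaolaboraGomezserrano2025, eq. (2.11)] -/
theorem nWc_succ_eq (r : ℝ) (n : ℕ) :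
    nWc r (w r) (z r) (n + 1) = NW_W r (W0 r) (Z0 r) * w r (n + 1) + NW_Z (W0 r) (Z0 r) * z r (n + 1)
      + (-(5 / 6) * ∑ k ∈ range n, w r (k + 1) * w r (n - k)
        - 1 / 3 * ∑ k ∈ range n, w r (k + 1) * z r (n - k)
        + 1 / 6 * ∑ k ∈ range n, z r (k + 1) * z r (n - k)) := by
  unfold nWc NW_W NW_Z
  rw [cauchy_succ', cauchy_succ', cauchy_succ', w_zero, z_zero]
  ring

/-- **The sharp `W`-step**: (2.9) solved for `w_{n+2}`, estimated termwise with its exact weights.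
[cite: BuckmasterCaolaboraGomezserrano2025, eq. (2.9), proof of Prop. 2.3] -/
theorem abs_w_succ_succ_sharp (hr : r < 2) (n : ℕ) :
    |w r (n + 2)| * (DW (W0 r) (Z0 r) * ((n : ℝ) + 2)) ≤
      (∑ k ∈ range (n + 1), |dWc (w r) (z r) (k + 1)| * (((n + 1 - (k + 1) : ℕ) : ℝ) + 1)
          * |w r (n + 1 - (k + 1) + 1)|)
        + |NW_W r (W0 r) (Z0 r)| * |w r (n + 1)| + |NW_Z (W0 r) (Z0 r)| * |z r (n + 1)|
        + (5 / 6 * ∑ k ∈ range n, |w r (k + 1)| * |w r (n - k)|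
          + 1 / 3 * ∑ k ∈ range n, |w r (k + 1)| * |z r (n - k)|
          + 1 / 6 * ∑ k ∈ range n, |z r (k + 1)| * |z r (n - k)|) := by
  have hD := DW_Ps_pos hr
  have hden : 0 < DW (W0 r) (Z0 r) * ((n : ℝ) + 2) := by positivity
  -- `|w_{n+2}| · D_{W,0}(n+2) = |restW(n+1)|`
  have hw : |w r (n + 2)| * (DW (W0 r) (Z0 r) * ((n : ℝ) + 2)) = |restW r (w r) (z r) (n + 1)| := by
    rw [w_succ_succ]
    unfold nextW
    rw [dWc_zero, show ((n + 1 : ℕ) : ℝ) + 1 = (n : ℝ) + 2 by push_cast; ring, abs_div, abs_neg,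
      abs_of_pos hden, div_mul_cancel₀ _ hden.ne']
  rw [hw]
  unfold restW
  rw [nWc_succ_eq]
  refine (abs_sub _ _).trans ?_
  have h1 : |∑ k ∈ range (n + 1), dWc (w r) (z r) (k + 1) * (((n + 1 - (k + 1) : ℕ) : ℝ) + 1)
      * w r (n + 1 - (k + 1) + 1)| ≤ ∑ k ∈ range (n + 1), |dWc (w r) (z r) (k + 1)|
      * (((n + 1 - (k + 1) : ℕ) : ℝ) + 1) * |w r (n + 1 - (k + 1) + 1)| := by
    refine (abs_sum_le_sum_abs _ _).trans (le_of_eq (sum_congr rfl fun k _ => ?_))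
    rw [abs_mul, abs_mul, abs_of_nonneg (by positivity : (0 : ℝ) ≤ ((n + 1 - (k + 1) : ℕ) : ℝ) + 1)]
  have h2 : |NW_W r (W0 r) (Z0 r) * w r (n + 1) + NW_Z (W0 r) (Z0 r) * z r (n + 1)
      + (-(5 / 6) * ∑ k ∈ range n, w r (k + 1) * w r (n - k)
        - 1 / 3 * ∑ k ∈ range n, w r (k + 1) * z r (n - k)
        + 1 / 6 * ∑ k ∈ range n, z r (k + 1) * z r (n - k))|
      ≤ |NW_W r (W0 r) (Z0 r)| * |w r (n + 1)| + |NW_Z (W0 r) (Z0 r)| * |z r (n + 1)|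
        + (5 / 6 * ∑ k ∈ range n, |w r (k + 1)| * |w r (n - k)|
          + 1 / 3 * ∑ k ∈ range n, |w r (k + 1)| * |z r (n - k)|
          + 1 / 6 * ∑ k ∈ range n, |z r (k + 1)| * |z r (n - k)|) := by
    have s1 : |∑ k ∈ range n, w r (k + 1) * w r (n - k)| ≤ ∑ k ∈ range n, |w r (k + 1)| * |w r (n - k)| :=
      (abs_sum_le_sum_abs _ _).trans (le_of_eq (sum_congr rfl fun k _ => abs_mul _ _))
    have s2 : |∑ k ∈ range n, w r (k + 1) * z r (n - k)| ≤ ∑ k ∈ range n, |w r (k + 1)| * |z r (n - k)| :=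
      (abs_sum_le_sum_abs _ _).trans (le_of_eq (sum_congr rfl fun k _ => abs_mul _ _))
    have s3 : |∑ k ∈ range n, z r (k + 1) * z r (n - k)| ≤ ∑ k ∈ range n, |z r (k + 1)| * |z r (n - k)| :=
      (abs_sum_le_sum_abs _ _).trans (le_of_eq (sum_congr rfl fun k _ => abs_mul _ _))
    refine (abs_add_le _ _).trans ?_
    refine add_le_add ((abs_add_le _ _).trans (by rw [abs_mul, abs_mul])) ?_
    refine (abs_add_le _ _).trans ?_
    refine le_trans (add_le_add ((abs_sub _ _).trans (add_le_add le_rfl le_rfl)) le_rfl) ?_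
    rw [abs_mul, abs_mul, abs_mul, abs_neg, abs_of_pos (by norm_num : (0 : ℝ) < 5 / 6),
      abs_of_pos (by norm_num : (0 : ℝ) < 1 / 3), abs_of_pos (by norm_num : (0 : ℝ) < 1 / 6)]
    linarith [mul_le_mul_of_nonneg_left s1 (by norm_num : (0 : ℝ) ≤ 5 / 6),
      mul_le_mul_of_nonneg_left s2 (by norm_num : (0 : ℝ) ≤ 1 / 3),
      mul_le_mul_of_nonneg_left s3 (by norm_num : (0 : ℝ) ≤ 1 / 6)]
  linarith

/-- **The sharp `Z`-step**: (2.10) solved for `z_{n+2}`, estimated termwise with its exact weights (no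
hypothesis: if `slopeZ(n+2) = 0` both sides vanish or the left side does).
[cite: BuckmasterCaolaboraGomezserrano2025, eq. (2.10), proof of Prop. 2.3] -/
theorem abs_z_succ_succ_sharp (r : ℝ) (n : ℕ) :
    |z r (n + 2)| * |slopeZ r (w r) (z r) (n + 2)| ≤
      |coefW (w r) (z r)| * |w r (n + 2)|
        + (∑ k ∈ range n, |dZc (w r) (z r) (k + 2)| * (((n - k : ℕ) : ℝ) + 1) * |z r (n - k + 1)|)
        + (1 / 3 * ∑ k ∈ range (n + 1), |w r (k + 1)| * |z r (n + 1 - k)|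
          + 5 / 6 * ∑ k ∈ range (n + 1), |z r (k + 1)| * |z r (n + 1 - k)|
          + 1 / 6 * ∑ k ∈ range (n + 1), |w r (k + 1)| * |w r (n + 1 - k)|) := by
  have hR : |restZ (w r) (z r) n| ≤
      (∑ k ∈ range n, |dZc (w r) (z r) (k + 2)| * (((n - k : ℕ) : ℝ) + 1) * |z r (n - k + 1)|)
        + (1 / 3 * ∑ k ∈ range (n + 1), |w r (k + 1)| * |z r (n + 1 - k)|
          + 5 / 6 * ∑ k ∈ range (n + 1), |z r (k + 1)| * |z r (n + 1 - k)|
          + 1 / 6 * ∑ k ∈ range (n + 1), |w r (k + 1)| * |w r (n + 1 - k)|) := by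
    have s0 : |∑ k ∈ range n, dZc (w r) (z r) (k + 2) * (((n - k : ℕ) : ℝ) + 1) * z r (n - k + 1)|
        ≤ ∑ k ∈ range n, |dZc (w r) (z r) (k + 2)| * (((n - k : ℕ) : ℝ) + 1) * |z r (n - k + 1)| := by
      refine (abs_sum_le_sum_abs _ _).trans (le_of_eq (sum_congr rfl fun k _ => ?_))
      rw [abs_mul, abs_mul, abs_of_nonneg (by positivity : (0 : ℝ) ≤ ((n - k : ℕ) : ℝ) + 1)]
    have s1 : |∑ k ∈ range (n + 1), w r (k + 1) * z r (n + 1 - k)|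
        ≤ ∑ k ∈ range (n + 1), |w r (k + 1)| * |z r (n + 1 - k)| :=
      (abs_sum_le_sum_abs _ _).trans (le_of_eq (sum_congr rfl fun k _ => abs_mul _ _))
    have s2 : |∑ k ∈ range (n + 1), z r (k + 1) * z r (n + 1 - k)|
        ≤ ∑ k ∈ range (n + 1), |z r (k + 1)| * |z r (n + 1 - k)| :=
      (abs_sum_le_sum_abs _ _).trans (le_of_eq (sum_congr rfl fun k _ => abs_mul _ _))
    have s3 : |∑ k ∈ range (n + 1), w r (k + 1) * w r (n + 1 - k)|
        ≤ ∑ k ∈ range (n + 1), |w r (k + 1)| * |w r (n + 1 - k)| :=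
      (abs_sum_le_sum_abs _ _).trans (le_of_eq (sum_congr rfl fun k _ => abs_mul _ _))
    unfold restZ
    refine (abs_sub _ _).trans ?_
    refine le_trans (add_le_add ((abs_add_le _ _).trans (add_le_add (abs_add_le _ _) le_rfl)) le_rfl) ?_
    rw [abs_mul, abs_mul, abs_mul, abs_of_pos (by norm_num : (0 : ℝ) < 5 / 6),
      abs_of_pos (by norm_num : (0 : ℝ) < 1 / 3), abs_of_pos (by norm_num : (0 : ℝ) < 1 / 6)]
    linarith [mul_le_mul_of_nonneg_left s1 (by norm_num : (0 : ℝ) ≤ 1 / 3),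
      mul_le_mul_of_nonneg_left s2 (by norm_num : (0 : ℝ) ≤ 5 / 6),
      mul_le_mul_of_nonneg_left s3 (by norm_num : (0 : ℝ) ≤ 1 / 6)]
  have hnum : |coefW (w r) (z r) * w r (n + 2) + restZ (w r) (z r) n| ≤
      |coefW (w r) (z r)| * |w r (n + 2)|
        + ((∑ k ∈ range n, |dZc (w r) (z r) (k + 2)| * (((n - k : ℕ) : ℝ) + 1) * |z r (n - k + 1)|)
        + (1 / 3 * ∑ k ∈ range (n + 1), |w r (k + 1)| * |z r (n + 1 - k)|
          + 5 / 6 * ∑ k ∈ range (n + 1), |z r (k + 1)| * |z r (n + 1 - k)|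
          + 1 / 6 * ∑ k ∈ range (n + 1), |w r (k + 1)| * |w r (n + 1 - k)|)) :=
    (abs_add_le _ _).trans (add_le_add (le_of_eq (abs_mul _ _)) hR)
  by_cases hs : slopeZ r (w r) (z r) (n + 2) = 0
  · rw [hs, abs_zero, mul_zero]
    exact le_trans (abs_nonneg _) (hnum.trans (le_of_eq (add_assoc _ _ _).symm))
  · rw [← abs_mul, z_succ_succ]
    unfold nextZ
    rw [div_mul_cancel₀ _ hs, abs_neg]
    exact hnum.trans (le_of_eq (add_assoc _ _ _).symm)

/-! ### Linear-time list convolutions -/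

/-- Dot product of two lists of naturals (truncated to the shorter). [folklore] -/
def dotN : List ℕ → List ℕ → ℕ
  | x :: xs, y :: ys => x * y + dotN xs ys
  | _, _ => 0

/-- Coefficientwise combination of two lists (truncated to the shorter). [folklore] -/
def zipN (f : ℕ → ℕ → ℕ) : List ℕ → List ℕ → List ℕ
  | x :: xs, y :: ys => f x y :: zipN f xs ys
  | _, _ => []

/-- `mulIdx s [a_s, a_{s+1}, …] = [s·a_s, (s+1)·a_{s+1}, …]`. [folklore] -/
def mulIdx : ℕ → List ℕ → List ℕ
  | _, [] => []
  | s, a :: L => s * a :: mulIdx (s + 1) L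

/-- [folklore] -/
theorem dotN_eq : ∀ (xs ys : List ℕ) (n : ℕ), xs.length = n → ys.length = n →
    dotN xs ys = ∑ k ∈ range n, xs.getD k 0 * ys.getD k 0
  | [], [], n, hx, _ => by simp [dotN, ← hx]
  | x :: xs, y :: ys, n, hx, hy => by
      obtain ⟨m, rfl⟩ : ∃ m, n = m + 1 := ⟨xs.length, by simpa using hx.symm⟩
      have hx' : xs.length = m := by simpa using hx
      have hy' : ys.length = m := by simpa using hy
      rw [dotN, dotN_eq xs ys m hx' hy', sum_range_succ']
      simp [add_comm]
  | [], _ :: _, n, hx, hy => by simp at hx hy; omega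
  | _ :: _, [], n, hx, hy => by simp at hx hy; omega

/-- [folklore] -/
theorem length_zipN (f : ℕ → ℕ → ℕ) : ∀ (xs ys : List ℕ), xs.length = ys.length →
    (zipN f xs ys).length = xs.length
  | [], [], _ => rfl
  | _ :: xs, _ :: ys, h => by simp [zipN, length_zipN f xs ys (by simpa using h)]
  | [], _ :: _, h => by simp at h
  | _ :: _, [], h => by simp at h

/-- [folklore] -/
theorem getD_zipN {f : ℕ → ℕ → ℕ} (hf : f 0 0 = 0) : ∀ (xs ys : List ℕ), xs.length = ys.length →
    ∀ k, (zipN f xs ys).getD k 0 = f (xs.getD k 0) (ys.getD k 0)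
  | [], [], _, k => by simp [zipN, hf]
  | x :: xs, y :: ys, h, 0 => by simp [zipN]
  | x :: xs, y :: ys, h, k + 1 => by
      simp only [zipN, List.getD_cons_succ]
      exact getD_zipN hf xs ys (by simpa using h) k
  | [], _ :: _, h, _ => by simp at h
  | _ :: _, [], h, _ => by simp at h

/-- [folklore] -/
theorem length_mulIdx : ∀ (s : ℕ) (L : List ℕ), (mulIdx s L).length = L.length
  | _, [] => rfl
  | s, _ :: L => by simp [mulIdx, length_mulIdx (s + 1) L]

/-- [folklore] -/
theorem getD_mulIdx : ∀ (s : ℕ) (L : List ℕ) (k : ℕ), (mulIdx s L).getD k 0 = (s + k) * L.getD k 0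
  | _, [], k => by simp [mulIdx]
  | s, a :: L, 0 => by simp [mulIdx]
  | s, a :: L, k + 1 => by
      simp only [mulIdx, List.getD_cons_succ]
      rw [getD_mulIdx (s + 1) L k]
      ring

/-- [folklore] -/
theorem getD_reverse_of_lt {L : List ℕ} {n k : ℕ} (hL : L.length = n) (hk : k < n) :
    L.reverse.getD k 0 = L.getD (n - 1 - k) 0 := by
  rw [List.getD_eq_getElem?_getD, List.getD_eq_getElem?_getD, List.getElem?_reverse (by omega), hL]

/-- The convolution `Σ_{k<n} xs_k · ys_{n−1−k}` as a dot product with the reversed list. [folklore] -/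
theorem dotN_reverse_eq {xs ys : List ℕ} {n : ℕ} (hx : xs.length = n) (hy : ys.length = n) :
    dotN xs ys.reverse = ∑ k ∈ range n, xs.getD k 0 * ys.getD (n - 1 - k) 0 := by
  rw [dotN_eq xs ys.reverse n hx (by simp [hy])]
  refine sum_congr rfl fun k hk => ?_
  rw [mem_range] at hk
  rw [getD_reverse_of_lt hy hk]

/-- [folklore] -/
theorem getD_drop (L : List ℕ) (s k : ℕ) : (L.drop s).getD k 0 = L.getD (s + k) 0 := by
  rw [List.getD_eq_getElem?_getD, List.getD_eq_getElem?_getD, List.getElem?_drop]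

/-- [folklore] -/
theorem getD_take_of_lt (L : List ℕ) {t k : ℕ} (hk : k < t) : (L.take t).getD k 0 = L.getD k 0 := by
  rw [List.getD_eq_getElem?_getD, List.getD_eq_getElem?_getD, List.getElem?_take, if_pos hk]

/-! ### The integer scalar majorant -/

/-- Entry `i` of a list of naturals (`0` past the end). [folklore] -/
def getN (L : List ℕ) (i : ℕ) : ℕ := L.getD i 0

/-- Upward rounding of a rational to a natural number. [folklore] -/
def ceilN (x : ℚ) : ℕ := (⌈x⌉ : ℤ).toNat

/-- [folklore] -/
theorem le_ceilN (x : ℚ) : x ≤ (ceilN x : ℚ) := by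
  unfold ceilN
  have h1 : x ≤ ((⌈x⌉ : ℤ) : ℚ) := Int.le_ceil x
  have h2 : ((⌈x⌉ : ℤ) : ℚ) ≤ (((⌈x⌉ : ℤ).toNat : ℕ) : ℚ) := by exact_mod_cast Int.self_le_toNat _
  exact h1.trans h2

/-- [folklore] -/
theorem le_ceilN_real (x : ℚ) : ((x : ℚ) : ℝ) ≤ (ceilN x : ℝ) := by
  have := (Rat.cast_le (K := ℝ)).mpr (le_ceilN x)
  simpa using this

/-- The rational bracket of the `W`-step (index `m = |TA| = n + 2`, scaled units `10^j/2^P`):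
`X = (1/3)Σ_{k≤n}(2Â_{k+1}+B̂_{k+1})(n+1−k)Â_{n+1−k} + (2^P/10)(nww Â_{n+1} + nwz B̂_{n+1})`
`+ (1/10)((5/6)ΣÂÂ + (1/3)ΣÂB̂ + (1/6)ΣB̂B̂)`. [cite: BuckmasterCaolaboraGomezserrano2025, eq. (2.9), proof of Prop. 2.3] -/
def bracketA (P : ℕ) (nww nwz : ℚ) (TA TB : List ℕ) : ℚ :=
  let n := TA.length - 2
  let A1 := TA.drop 1
  let B1 := TB.drop 1
  let lin := dotN (zipN (fun a b => 2 * a + b) A1 B1) (mulIdx 1 A1).reverse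
  let An := A1.take n
  let Bn := B1.take n
  let qaa := dotN An An.reverse
  let qab := dotN An Bn.reverse
  let qbb := dotN Bn Bn.reverse
  (lin : ℚ) / 3 + (2 : ℚ) ^ P / 10 * (nww * (getN TA (n + 1) : ℚ) + nwz * (getN TB (n + 1) : ℚ))
    + 1 / 10 * (5 / 6 * (qaa : ℚ) + 1 / 3 * (qab : ℚ) + 1 / 6 * (qbb : ℚ))

/-- **One `W`-step of the integer majorant**: `Â_m = ⌈X/(2^P · dlo · m)⌉`, `m = |TA|`.
[cite: BuckmasterCaolaboraGomezserrano2025, eq. (2.9), proof of Prop. 2.3] -/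
def stepA (P : ℕ) (dlo nww nwz : ℚ) (TA TB : List ℕ) : ℕ :=
  ceilN (bracketA P nww nwz TA TB / ((2 : ℚ) ^ P * dlo * (TA.length : ℚ)))

/-- The rational bracket of the `Z`-step (index `m = |TB| = n + 2`, `|TA| = m + 1` already holds `Â_m`):
`Y = 2^P·cw·Â_m + (10/3)Σ_{k<n}(Â_{k+2}+2B̂_{k+2})(n−k+1)B̂_{n−k+1} + (1/3)ΣÂB̂ + (5/6)ΣB̂B̂ + (1/6)ΣÂÂ`.
[cite: BuckmasterCaolaboraGomezserrano2025, eq. (2.10), proof of Prop. 2.3] -/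
def bracketB (P : ℕ) (cw : ℚ) (TA TB : List ℕ) : ℚ :=
  let m := TB.length
  let n := m - 2
  let A2 := (TA.drop 2).take n
  let B2 := TB.drop 2
  let lin := dotN (zipN (fun a b => a + 2 * b) A2 B2) (mulIdx 2 B2).reverse
  let X1 := (TA.drop 1).take (n + 1)
  let Y1 := TB.drop 1
  let qab := dotN X1 Y1.reverse
  let qbb := dotN Y1 Y1.reverse
  let qaa := dotN X1 X1.reverse
  (2 : ℚ) ^ P * cw * (getN TA m : ℚ) + 10 / 3 * (lin : ℚ)
    + (1 / 3 * (qab : ℚ) + 5 / 6 * (qbb : ℚ) + 1 / 6 * (qaa : ℚ))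

/-- **One `Z`-step of the integer majorant**: `B̂_m = ⌈Y/(2^P · dz1 · (m − kk))⌉`, `m = |TB|`.
[cite: BuckmasterCaolaboraGomezserrano2025, eq. (2.10), proof of Prop. 2.3] -/
def stepB (P : ℕ) (cw dz1 kk : ℚ) (TA TB : List ℕ) : ℕ :=
  ceilN (bracketB P cw TA TB / ((2 : ℚ) ^ P * dz1 * ((TB.length : ℚ) - kk)))

/-- **The restarted scalar majorant**: the head data `(HA, HB)` extended by `s` pairs of steps.
[cite: BuckmasterCaolaboraGomezserrano2025, proof of Prop. 2.3] -/
def majPair (P : ℕ) (dlo nww nwz cw dz1 kk : ℚ) (HA HB : List ℕ) : ℕ → List ℕ × List ℕ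
  | 0 => (HA, HB)
  | s + 1 =>
      let T := majPair P dlo nww nwz cw dz1 kk HA HB s
      let TA' := T.1 ++ [stepA P dlo nww nwz T.1 T.2]
      (TA', T.2 ++ [stepB P cw dz1 kk TA' T.2])

/-! ### Soundness of the steps -/

section Sound

variable {P : ℕ} {dlo nww nwz cw dz1 kk : ℚ}

/-- The scaled unit `u_i = 10^i/2^P`. [folklore] -/
def unitP (P i : ℕ) : ℝ := (10 : ℝ) ^ i / (2 : ℝ) ^ P

/-- [folklore] -/
theorem unitP_pos (P i : ℕ) : 0 < unitP P i := by unfold unitP; positivity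

/-- [folklore] -/
theorem unitP_mul (P i j : ℕ) : unitP P i * unitP P j = (10 : ℝ) ^ (i + j) / ((2 : ℝ) ^ P * (2 : ℝ) ^ P) := by
  unfold unitP; rw [pow_add]; field_simp

/-- A product of two enclosed coefficients, in the units of the step. [folklore] -/
theorem prod_le_unit {P : ℕ} {x y cx cy : ℝ} {i j N : ℕ} (hx : |x| ≤ cx * unitP P i) (hy : |y| ≤ cy * unitP P j)
    (hcx : 0 ≤ cx) (hN : i + j = N) :
    |x| * |y| ≤ (10 : ℝ) ^ N / ((2 : ℝ) ^ P * (2 : ℝ) ^ P) * (cx * cy) := by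
  have hu := unitP_pos P i
  calc |x| * |y| ≤ (cx * unitP P i) * (cy * unitP P j) :=
        mul_le_mul hx hy (abs_nonneg _) (by positivity)
    _ = cx * cy * (unitP P i * unitP P j) := by ring
    _ = _ := by rw [unitP_mul, hN]; ring

/-- The quadratic sums `Σ_{k<n} L_{k+1} M_{n−k}` as dot products. [folklore] -/
theorem dotN_quad1_cast {L M : List ℕ} {n : ℕ} (hL : L.length = n + 2) (hM : M.length = n + 2) :
    (dotN ((L.drop 1).take n) ((M.drop 1).take n).reverse : ℝ)
      = ∑ k ∈ range n, (getN L (k + 1) : ℝ) * (getN M (n - k) : ℝ) := by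
  have hl : ((L.drop 1).take n).length = n := by simp [hL]
  have hm : ((M.drop 1).take n).length = n := by simp [hM]
  rw [dotN_reverse_eq hl hm]
  push_cast
  refine sum_congr rfl fun k hk => ?_
  rw [mem_range] at hk
  rw [getD_take_of_lt _ hk, getD_take_of_lt _ (by omega), getD_drop, getD_drop]
  simp only [getN]
  rw [show 1 + k = k + 1 by omega, show 1 + (n - 1 - k) = n - k by omega]

/-- **Soundness of `stepA`.** [cite: BuckmasterCaolaboraGomezserrano2025, eq. (2.9), proof of Prop. 2.3] -/
theorem abs_w_le_stepA (hr : r < 2) (hdlo : 0 < dlo) (hD : (dlo : ℝ) ≤ DW (W0 r) (Z0 r))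
    (hnww : |NW_W r (W0 r) (Z0 r)| ≤ nww) (hnwz : |NW_Z (W0 r) (Z0 r)| ≤ nwz)
    {TA TB : List ℕ} {n : ℕ} (hTA : TA.length = n + 2) (hTB : TB.length = n + 2)
    (hA : ∀ i, i ≤ n + 1 → |w r i| ≤ (getN TA i : ℝ) * unitP P i)
    (hB : ∀ i, i ≤ n + 1 → |z r i| ≤ (getN TB i : ℝ) * unitP P i) :
    |w r (n + 2)| ≤ (stepA P dlo nww nwz TA TB : ℝ) * unitP P (n + 2) := by
  -- notation
  set a : ℕ → ℝ := fun i => (getN TA i : ℝ) with ha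
  set b : ℕ → ℝ := fun i => (getN TB i : ℝ) with hb
  have ha0 : ∀ i, 0 ≤ a i := fun i => by simp [ha]
  have hb0 : ∀ i, 0 ≤ b i := fun i => by simp [hb]
  have hu := unitP_pos P
  set U : ℝ := (10 : ℝ) ^ (n + 2) / ((2 : ℝ) ^ P * (2 : ℝ) ^ P) with hU
  have hU0 : 0 < U := by rw [hU]; positivity
  have hsharp := abs_w_succ_succ_sharp hr n
  -- (1) the linear convolution
  have h1 : (∑ k ∈ range (n + 1), |dWc (w r) (z r) (k + 1)| * (((n + 1 - (k + 1) : ℕ) : ℝ) + 1)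
      * |w r (n + 1 - (k + 1) + 1)|)
      ≤ ∑ k ∈ range (n + 1), U * (1 / 3 * ((2 * a (k + 1) + b (k + 1)) * ((((n - k : ℕ) : ℝ) + 1) * a (n - k + 1)))) := by
    refine sum_le_sum fun k hk => ?_
    rw [mem_range] at hk
    have e1 : n + 1 - (k + 1) = n - k := by omega
    rw [e1]
    have hd : |dWc (w r) (z r) (k + 1)| ≤ (2 * a (k + 1) + b (k + 1)) / 3 * unitP P (k + 1) := by
      rw [dWc_succ, abs_div, abs_of_pos (by norm_num : (0 : ℝ) < 3), div_mul_eq_mul_div]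
      refine div_le_div_of_nonneg_right ((abs_add_le _ _).trans ?_) (by norm_num)
      have hw1 := hA (k + 1) (by omega); have hz1 := hB (k + 1) (by omega)
      rw [abs_mul, abs_two]
      linarith
    have hnn : (0 : ℝ) ≤ ((n - k : ℕ) : ℝ) + 1 := by positivity
    have hx : |dWc (w r) (z r) (k + 1) * ((((n - k : ℕ) : ℝ) + 1))| ≤ ((2 * a (k + 1) + b (k + 1)) / 3 * (((n - k : ℕ) : ℝ) + 1)) * unitP P (k + 1) := by
      rw [abs_mul, abs_of_nonneg hnn]
      nlinarith [hd, hu (k + 1)]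
    have := prod_le_unit hx (hA (n - k + 1) (by omega))
      (by have := ha0 (k + 1); have := hb0 (k + 1); positivity) (show k + 1 + (n - k + 1) = n + 2 by omega)
    rw [abs_mul, abs_of_nonneg hnn] at this
    rw [← hU] at this
    calc |dWc (w r) (z r) (k + 1)| * (((n - k : ℕ) : ℝ) + 1) * |w r (n - k + 1)|
        = |dWc (w r) (z r) (k + 1)| * ((((n - k : ℕ) : ℝ) + 1)) * |w r (n - k + 1)| := by ring
      _ ≤ U * ((2 * a (k + 1) + b (k + 1)) / 3 * (((n - k : ℕ) : ℝ) + 1) * a (n - k + 1)) := this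
      _ = _ := by ring
  rw [← mul_sum, ← mul_sum] at h1
  -- (2) the two linear terms
  have h2 : |NW_W r (W0 r) (Z0 r)| * |w r (n + 1)| + |NW_Z (W0 r) (Z0 r)| * |z r (n + 1)|
      ≤ U * ((2 : ℝ) ^ P / 10 * ((nww : ℝ) * a (n + 1) + (nwz : ℝ) * b (n + 1))) := by
    have e : U * ((2 : ℝ) ^ P / 10 * ((nww : ℝ) * a (n + 1) + (nwz : ℝ) * b (n + 1)))
        = (nww : ℝ) * (a (n + 1) * unitP P (n + 1)) + (nwz : ℝ) * (b (n + 1) * unitP P (n + 1)) := by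
      rw [hU]; unfold unitP; rw [pow_succ]; field_simp
    rw [e]
    have hnww0 : (0 : ℝ) ≤ nww := le_trans (abs_nonneg _) hnww
    have hnwz0 : (0 : ℝ) ≤ nwz := le_trans (abs_nonneg _) hnwz
    exact add_le_add (mul_le_mul hnww (hA (n + 1) le_rfl) (abs_nonneg _) hnww0)
      (mul_le_mul hnwz (hB (n + 1) le_rfl) (abs_nonneg _) hnwz0)
  -- (3) the quadratic terms
  have hq : ∀ {f g : ℕ → ℝ} {c d : ℕ → ℝ}, (∀ i, i ≤ n + 1 → |f i| ≤ c i * unitP P i) →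
      (∀ i, i ≤ n + 1 → |g i| ≤ d i * unitP P i) → (∀ i, 0 ≤ c i) →
      (∑ k ∈ range n, |f (k + 1)| * |g (n - k)|) ≤ U * (1 / 10 * ∑ k ∈ range n, c (k + 1) * d (n - k)) := by
    intro f g c d hf hg hc
    rw [← mul_assoc, mul_sum]
    refine sum_le_sum fun k hk => ?_
    rw [mem_range] at hk
    have := prod_le_unit (hf (k + 1) (by omega)) (hg (n - k) (by omega)) (hc _) (show k + 1 + (n - k) = n + 1 by omega)
    refine this.trans (le_of_eq ?_)
    rw [hU, pow_succ _ (n + 1)]; ring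
  have h3 := hq hA hA ha0
  have h4 := hq hA hB ha0
  have h5 := hq hB hB hb0
  -- the real bracket
  set Xr : ℝ := 1 / 3 * (∑ k ∈ range (n + 1), (2 * a (k + 1) + b (k + 1)) * ((((n - k : ℕ) : ℝ) + 1) * a (n - k + 1)))
    + (2 : ℝ) ^ P / 10 * ((nww : ℝ) * a (n + 1) + (nwz : ℝ) * b (n + 1))
    + 1 / 10 * (5 / 6 * (∑ k ∈ range n, a (k + 1) * a (n - k)) + 1 / 3 * (∑ k ∈ range n, a (k + 1) * b (n - k))
      + 1 / 6 * (∑ k ∈ range n, b (k + 1) * b (n - k))) with hXr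
  have hreal : |w r (n + 2)| * (DW (W0 r) (Z0 r) * ((n : ℝ) + 2)) ≤ U * Xr := by
    refine hsharp.trans ?_
    rw [hXr]
    nlinarith [h1, h2, h3, h4, h5, hU0]
  -- identify `Xr` with the cast of `bracketA`
  have hTA1 : (TA.drop 1).length = n + 1 := by simp [hTA]
  have hTB1 : (TB.drop 1).length = n + 1 := by simp [hTB]
  have hlin : (dotN (zipN (fun a b => 2 * a + b) (TA.drop 1) (TB.drop 1)) (mulIdx 1 (TA.drop 1)).reverse : ℝ)
      = ∑ k ∈ range (n + 1), (2 * a (k + 1) + b (k + 1)) * ((((n - k : ℕ) : ℝ) + 1) * a (n - k + 1)) := by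
    have hz : (zipN (fun a b => 2 * a + b) (TA.drop 1) (TB.drop 1)).length = n + 1 := by
      rw [length_zipN _ _ _ (by rw [hTA1, hTB1]), hTA1]
    have hm : (mulIdx 1 (TA.drop 1)).length = n + 1 := by rw [length_mulIdx, hTA1]
    rw [dotN_reverse_eq hz hm]
    push_cast
    refine sum_congr rfl fun k hk => ?_
    rw [mem_range] at hk
    rw [getD_zipN (by norm_num) _ _ (by rw [hTA1, hTB1]), getD_mulIdx, getD_drop, getD_drop, getD_drop]
    simp only [ha, hb, getN]
    rw [show 1 + (n - k) = n - k + 1 by omega, show 1 + k = k + 1 by omega]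
    push_cast
    ring
  have hX : ((bracketA P nww nwz TA TB : ℚ) : ℝ) = Xr := by
    unfold bracketA
    simp only [hTA, Nat.add_sub_cancel]
    push_cast
    rw [hlin, dotN_quad1_cast hTA hTA, dotN_quad1_cast hTA hTB, dotN_quad1_cast hTB hTB, hXr]
    simp only [ha, hb]
    ring
  -- conclude with the ceiling
  have hDpos : (0 : ℝ) < DW (W0 r) (Z0 r) := DW_Ps_pos hr
  have hdloR : (0 : ℝ) < dlo := by exact_mod_cast hdlo
  have hm2 : (0 : ℝ) < (n : ℝ) + 2 := by positivity
  have h2P : (0 : ℝ) < (2 : ℝ) ^ P := by positivity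
  have hXr0 : 0 ≤ Xr := by
    have := mul_nonneg (abs_nonneg (w r (n + 2))) (mul_pos hDpos hm2).le
    nlinarith [hreal, hU0]
  have hq2 : (((bracketA P nww nwz TA TB / ((2 : ℚ) ^ P * dlo * (TA.length : ℚ)) : ℚ)) : ℝ)
      = Xr / ((2 : ℝ) ^ P * dlo * ((n : ℝ) + 2)) := by
    push_cast
    rw [hX, hTA]
    push_cast
    ring
  have hc : Xr / ((2 : ℝ) ^ P * dlo * ((n : ℝ) + 2)) ≤ (stepA P dlo nww nwz TA TB : ℝ) := by
    rw [← hq2]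
    exact le_ceilN_real _
  calc |w r (n + 2)| ≤ U * Xr / (DW (W0 r) (Z0 r) * ((n : ℝ) + 2)) := by
        rw [le_div_iff₀ (mul_pos hDpos hm2)]; exact hreal
    _ ≤ U * Xr / ((dlo : ℝ) * ((n : ℝ) + 2)) := by
        refine div_le_div_of_nonneg_left (mul_nonneg hU0.le hXr0) (mul_pos hdloR hm2) ?_
        exact mul_le_mul_of_nonneg_right hD hm2.le
    _ = (Xr / ((2 : ℝ) ^ P * dlo * ((n : ℝ) + 2))) * unitP P (n + 2) := by
        rw [hU]; unfold unitP; field_simp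
    _ ≤ (stepA P dlo nww nwz TA TB : ℝ) * unitP P (n + 2) :=
        mul_le_mul_of_nonneg_right hc (hu _).le

/-- **Soundness of `stepB`.** [cite: BuckmasterCaolaboraGomezserrano2025, eq. (2.10), proof of Prop. 2.3] -/
theorem abs_z_le_stepB (hdz : 0 < dz1) {n : ℕ} (hkk : (kk : ℝ) < (n : ℝ) + 2)
    (hsl : (dz1 : ℝ) * ((n : ℝ) + 2 - kk) ≤ |slopeZ r (w r) (z r) (n + 2)|)
    (hcw : |coefW (w r) (z r)| ≤ cw)
    {TA TB : List ℕ} (hTA : TA.length = n + 3) (hTB : TB.length = n + 2)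
    (hA : ∀ i, i ≤ n + 2 → |w r i| ≤ (getN TA i : ℝ) * unitP P i)
    (hB : ∀ i, i ≤ n + 1 → |z r i| ≤ (getN TB i : ℝ) * unitP P i) :
    |z r (n + 2)| ≤ (stepB P cw dz1 kk TA TB : ℝ) * unitP P (n + 2) := by
  set a : ℕ → ℝ := fun i => (getN TA i : ℝ) with ha
  set b : ℕ → ℝ := fun i => (getN TB i : ℝ) with hb
  have ha0 : ∀ i, 0 ≤ a i := fun i => by simp [ha]
  have hb0 : ∀ i, 0 ≤ b i := fun i => by simp [hb]
  have hu := unitP_pos P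
  set U : ℝ := (10 : ℝ) ^ (n + 2) / ((2 : ℝ) ^ P * (2 : ℝ) ^ P) with hU
  have hU0 : 0 < U := by rw [hU]; positivity
  have hsharp := abs_z_succ_succ_sharp r n
  -- (0) the `coefW` term
  have h0 : |coefW (w r) (z r)| * |w r (n + 2)| ≤ U * ((2 : ℝ) ^ P * cw * a (n + 2)) := by
    have e : U * ((2 : ℝ) ^ P * cw * a (n + 2)) = (cw : ℝ) * (a (n + 2) * unitP P (n + 2)) := by
      rw [hU]; unfold unitP; field_simp
    rw [e]
    exact mul_le_mul hcw (hA (n + 2) le_rfl) (abs_nonneg _) (le_trans (abs_nonneg _) hcw)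
  -- (1) the linear convolution
  have h1 : (∑ k ∈ range n, |dZc (w r) (z r) (k + 2)| * (((n - k : ℕ) : ℝ) + 1) * |z r (n - k + 1)|)
      ≤ ∑ k ∈ range n, U * (10 / 3 * ((a (k + 2) + 2 * b (k + 2)) * ((((n - k : ℕ) : ℝ) + 1) * b (n - k + 1)))) := by
    refine sum_le_sum fun k hk => ?_
    rw [mem_range] at hk
    have hd : |dZc (w r) (z r) (k + 2)| ≤ (a (k + 2) + 2 * b (k + 2)) / 3 * unitP P (k + 2) := by
      rw [show k + 2 = (k + 1) + 1 from rfl, dZc_succ, abs_div, abs_of_pos (by norm_num : (0 : ℝ) < 3),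
        div_mul_eq_mul_div]
      refine div_le_div_of_nonneg_right ((abs_add_le _ _).trans ?_) (by norm_num)
      have hw1 := hA (k + 2) (by omega); have hz1 := hB (k + 2) (by omega)
      rw [abs_mul, abs_two]
      simp only [show k + 1 + 1 = k + 2 from rfl]
      linarith
    have hnn : (0 : ℝ) ≤ ((n - k : ℕ) : ℝ) + 1 := by positivity
    have hx : |dZc (w r) (z r) (k + 2) * ((((n - k : ℕ) : ℝ) + 1))| ≤ ((a (k + 2) + 2 * b (k + 2)) / 3 * (((n - k : ℕ) : ℝ) + 1)) * unitP P (k + 2) := by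
      rw [abs_mul, abs_of_nonneg hnn]
      nlinarith [hd, hu (k + 2)]
    have := prod_le_unit hx (hB (n - k + 1) (by omega))
      (by have := ha0 (k + 2); have := hb0 (k + 2); positivity) (show k + 2 + (n - k + 1) = (n + 2) + 1 by omega)
    rw [abs_mul, abs_of_nonneg hnn, pow_succ] at this
    calc |dZc (w r) (z r) (k + 2)| * (((n - k : ℕ) : ℝ) + 1) * |z r (n - k + 1)|
        ≤ (10 : ℝ) ^ (n + 2) * 10 / ((2 : ℝ) ^ P * (2 : ℝ) ^ P)
            * ((a (k + 2) + 2 * b (k + 2)) / 3 * (((n - k : ℕ) : ℝ) + 1) * b (n - k + 1)) := this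
      _ = _ := by rw [hU]; ring
  rw [← mul_sum, ← mul_sum] at h1
  -- (2) the quadratic terms
  have hq : ∀ {f g : ℕ → ℝ} {c d : ℕ → ℝ}, (∀ i, i ≤ n + 1 → |f i| ≤ c i * unitP P i) →
      (∀ i, i ≤ n + 1 → |g i| ≤ d i * unitP P i) → (∀ i, 0 ≤ c i) →
      (∑ k ∈ range (n + 1), |f (k + 1)| * |g (n + 1 - k)|) ≤ U * (∑ k ∈ range (n + 1), c (k + 1) * d (n + 1 - k)) := by
    intro f g c d hf hg hc
    rw [mul_sum]
    refine sum_le_sum fun k hk => ?_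
    rw [mem_range] at hk
    have := prod_le_unit (hf (k + 1) (by omega)) (hg (n + 1 - k) (by omega)) (hc _)
      (show k + 1 + (n + 1 - k) = n + 2 by omega)
    rw [← hU] at this
    exact this
  have hA' : ∀ i, i ≤ n + 1 → |w r i| ≤ a i * unitP P i := fun i hi => hA i (by omega)
  have h3 := hq hA' hB ha0
  have h4 := hq hB hB hb0
  have h5 := hq hA' hA' ha0
  -- the real bracket
  set Yr : ℝ := (2 : ℝ) ^ P * cw * a (n + 2)
    + 10 / 3 * (∑ k ∈ range n, (a (k + 2) + 2 * b (k + 2)) * ((((n - k : ℕ) : ℝ) + 1) * b (n - k + 1)))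
    + (1 / 3 * (∑ k ∈ range (n + 1), a (k + 1) * b (n + 1 - k))
      + 5 / 6 * (∑ k ∈ range (n + 1), b (k + 1) * b (n + 1 - k))
      + 1 / 6 * (∑ k ∈ range (n + 1), a (k + 1) * a (n + 1 - k))) with hYr
  have hreal : |z r (n + 2)| * |slopeZ r (w r) (z r) (n + 2)| ≤ U * Yr := by
    refine hsharp.trans ?_
    rw [hYr]
    nlinarith [h0, h1, h3, h4, h5, hU0]
  -- identify `Yr` with the cast of `bracketB`
  have hTA2 : ((TA.drop 2).take n).length = n := by simp [hTA]
  have hTB2 : (TB.drop 2).length = n := by simp [hTB]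
  have hlin : (dotN (zipN (fun a b => a + 2 * b) ((TA.drop 2).take n) (TB.drop 2)) (mulIdx 2 (TB.drop 2)).reverse : ℝ)
      = ∑ k ∈ range n, (a (k + 2) + 2 * b (k + 2)) * ((((n - k : ℕ) : ℝ) + 1) * b (n - k + 1)) := by
    have hz : (zipN (fun a b => a + 2 * b) ((TA.drop 2).take n) (TB.drop 2)).length = n := by
      rw [length_zipN _ _ _ (by rw [hTA2, hTB2]), hTA2]
    have hm : (mulIdx 2 (TB.drop 2)).length = n := by rw [length_mulIdx, hTB2]
    rw [dotN_reverse_eq hz hm]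
    push_cast
    refine sum_congr rfl fun k hk => ?_
    rw [mem_range] at hk
    rw [getD_zipN (by norm_num) _ _ (by rw [hTA2, hTB2]), getD_mulIdx, getD_take_of_lt _ hk, getD_drop,
      getD_drop, getD_drop]
    simp only [ha, hb, getN]
    rw [show 2 + (n - 1 - k) = n - k + 1 by omega, show 2 + k = k + 2 by omega]
    push_cast
    ring
  have hquad : ∀ {L M : List ℕ}, L.length = n + 3 → M.length = n + 2 →
      (dotN ((L.drop 1).take (n + 1)) (M.drop 1).reverse : ℝ)
        = ∑ k ∈ range (n + 1), (getN L (k + 1) : ℝ) * (getN M (n + 1 - k) : ℝ) := by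
    intro L M hL hM
    have hl : ((L.drop 1).take (n + 1)).length = n + 1 := by simp [hL]
    have hm : (M.drop 1).length = n + 1 := by simp [hM]
    rw [dotN_reverse_eq hl hm]
    push_cast
    refine sum_congr rfl fun k hk => ?_
    rw [mem_range] at hk
    rw [getD_take_of_lt _ hk, getD_drop, getD_drop]
    simp only [getN]
    rw [show 1 + k = k + 1 by omega, show 1 + (n - k) = n + 1 - k by omega]
  have hquad' : ∀ {M : List ℕ}, M.length = n + 2 →
      (dotN (M.drop 1) (M.drop 1).reverse : ℝ)
        = ∑ k ∈ range (n + 1), (getN M (k + 1) : ℝ) * (getN M (n + 1 - k) : ℝ) := by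
    intro M hM
    have hm : (M.drop 1).length = n + 1 := by simp [hM]
    rw [dotN_reverse_eq hm hm]
    push_cast
    refine sum_congr rfl fun k hk => ?_
    rw [mem_range] at hk
    rw [getD_drop, getD_drop]
    simp only [getN]
    rw [show 1 + k = k + 1 by omega, show 1 + (n - k) = n + 1 - k by omega]
  have hquad'' : ∀ {L : List ℕ}, L.length = n + 3 →
      (dotN ((L.drop 1).take (n + 1)) ((L.drop 1).take (n + 1)).reverse : ℝ)
        = ∑ k ∈ range (n + 1), (getN L (k + 1) : ℝ) * (getN L (n + 1 - k) : ℝ) := by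
    intro L hL
    have hl : ((L.drop 1).take (n + 1)).length = n + 1 := by simp [hL]
    rw [dotN_reverse_eq hl hl]
    push_cast
    refine sum_congr rfl fun k hk => ?_
    rw [mem_range] at hk
    rw [getD_take_of_lt _ hk, getD_take_of_lt _ (by omega), getD_drop, getD_drop]
    simp only [getN]
    rw [show 1 + k = k + 1 by omega, show 1 + (n - k) = n + 1 - k by omega]
  have hY : ((bracketB P cw TA TB : ℚ) : ℝ) = Yr := by
    unfold bracketB
    simp only [hTB, Nat.add_sub_cancel]
    push_cast
    rw [hlin, hquad hTA hTB, hquad' hTB, hquad'' hTA, hYr]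
  -- conclude with the ceiling
  have hdzR : (0 : ℝ) < dz1 := by exact_mod_cast hdz
  have hden : (0 : ℝ) < (dz1 : ℝ) * ((n : ℝ) + 2 - kk) := mul_pos hdzR (by linarith)
  have hslpos : 0 < |slopeZ r (w r) (z r) (n + 2)| := lt_of_lt_of_le hden hsl
  have hYr0 : 0 ≤ Yr := by
    have := mul_nonneg (abs_nonneg (z r (n + 2))) hslpos.le
    nlinarith [hreal, hU0]
  have hq2 : (((bracketB P cw TA TB / ((2 : ℚ) ^ P * dz1 * ((TB.length : ℚ) - kk)) : ℚ)) : ℝ)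
      = Yr / ((2 : ℝ) ^ P * dz1 * ((n : ℝ) + 2 - kk)) := by
    push_cast
    rw [hY, hTB]
    push_cast
    ring
  have hc : Yr / ((2 : ℝ) ^ P * dz1 * ((n : ℝ) + 2 - kk)) ≤ (stepB P cw dz1 kk TA TB : ℝ) := by
    rw [← hq2]
    exact le_ceilN_real _
  calc |z r (n + 2)| ≤ U * Yr / |slopeZ r (w r) (z r) (n + 2)| := by
        rw [le_div_iff₀ hslpos]; exact hreal
    _ ≤ U * Yr / ((dz1 : ℝ) * ((n : ℝ) + 2 - kk)) :=
        div_le_div_of_nonneg_left (mul_nonneg hU0.le hYr0) hden hsl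
    _ = (Yr / ((2 : ℝ) ^ P * dz1 * ((n : ℝ) + 2 - kk))) * unitP P (n + 2) := by
        rw [hU]; unfold unitP; field_simp
    _ ≤ (stepB P cw dz1 kk TA TB : ℝ) * unitP P (n + 2) :=
        mul_le_mul_of_nonneg_right hc (hu _).le

/-! ### Iterating: soundness of `majPair` -/

variable {HA HB : List ℕ}

/-- [folklore] -/
theorem length_majPair : ∀ s, (majPair P dlo nww nwz cw dz1 kk HA HB s).1.length = HA.length + s ∧
    (majPair P dlo nww nwz cw dz1 kk HA HB s).2.length = HB.length + s
  | 0 => ⟨rfl, rfl⟩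
  | s + 1 => by
      obtain ⟨h1, h2⟩ := length_majPair s
      simp only [majPair, List.length_append, List.length_singleton, h1, h2]
      omega

/-- [folklore] -/
theorem getN_append_left {L M : List ℕ} {i : ℕ} (hi : i < L.length) : getN (L ++ M) i = getN L i := by
  unfold getN
  rw [List.getD_eq_getElem?_getD, List.getD_eq_getElem?_getD, List.getElem?_append_left hi]

/-- [folklore] -/
theorem getN_append_single (L : List ℕ) (x : ℕ) : getN (L ++ [x]) L.length = x := by
  unfold getN
  rw [List.getD_eq_getElem?_getD, List.getElem?_append_right le_rfl]
  simp

/-- **Soundness of the restarted scalar majorant.** If the head data enclose `|w_i|`, `|z_i|` (`i < K = |HA| = |HB|`,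
`K ≥ 2`) in the units `10^i/2^P`, and the window constants are valid (`kk < K`, `dz1 (m − kk) ≤ |slopeZ(m)|` for
`m ≥ K`), then after `s` steps the lists enclose `|w_i|`, `|z_i|` for all `i < K + s`.
[cite: BuckmasterCaolaboraGomezserrano2025, proof of Prop. 2.3] -/
theorem abs_le_majPair (hr : r < 2) (hdlo : 0 < dlo) (hD : (dlo : ℝ) ≤ DW (W0 r) (Z0 r))
    (hnww : |NW_W r (W0 r) (Z0 r)| ≤ nww) (hnwz : |NW_Z (W0 r) (Z0 r)| ≤ nwz)
    (hcw : |coefW (w r) (z r)| ≤ cw) (hdz : 0 < dz1) (hkk : (kk : ℝ) < HA.length)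
    (hsl : ∀ m : ℕ, HA.length ≤ m → (dz1 : ℝ) * ((m : ℝ) - kk) ≤ |slopeZ r (w r) (z r) m|)
    (hlen : HB.length = HA.length) (h2 : 2 ≤ HA.length)
    (hHA : ∀ i, i < HA.length → |w r i| ≤ (getN HA i : ℝ) * unitP P i)
    (hHB : ∀ i, i < HA.length → |z r i| ≤ (getN HB i : ℝ) * unitP P i) :
    ∀ s i, i < HA.length + s →
      |w r i| ≤ (getN (majPair P dlo nww nwz cw dz1 kk HA HB s).1 i : ℝ) * unitP P i ∧
        |z r i| ≤ (getN (majPair P dlo nww nwz cw dz1 kk HA HB s).2 i : ℝ) * unitP P i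
  | 0, i, hi => ⟨hHA i (by simpa using hi), hHB i (by simpa using hi)⟩
  | s + 1, i, hi => by
      have ih := abs_le_majPair hr hdlo hD hnww hnwz hcw hdz hkk hsl hlen h2 hHA hHB s
      obtain ⟨hl1, hl2⟩ := length_majPair (P := P) (dlo := dlo) (nww := nww) (nwz := nwz) (cw := cw)
        (dz1 := dz1) (kk := kk) (HA := HA) (HB := HB) s
      set T := majPair P dlo nww nwz cw dz1 kk HA HB s with hT
      set K := HA.length with hK
      obtain ⟨n, hn⟩ : ∃ n, K + s = n + 2 := ⟨K + s - 2, by omega⟩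
      -- the new `W`-entry
      have hTA : T.1.length = n + 2 := by rw [hl1, hn]
      have hTB : T.2.length = n + 2 := by rw [hl2, hlen, hn]
      have hAold : ∀ j, j ≤ n + 1 → |w r j| ≤ (getN T.1 j : ℝ) * unitP P j := fun j hj => (ih j (by omega)).1
      have hBold : ∀ j, j ≤ n + 1 → |z r j| ≤ (getN T.2 j : ℝ) * unitP P j := fun j hj => (ih j (by omega)).2
      have hwnew : |w r (n + 2)| ≤ (stepA P dlo nww nwz T.1 T.2 : ℝ) * unitP P (n + 2) :=
        abs_w_le_stepA hr hdlo hD hnww hnwz hTA hTB hAold hBold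
      set TA' := T.1 ++ [stepA P dlo nww nwz T.1 T.2] with hTA'
      have hTA'len : TA'.length = n + 3 := by rw [hTA', List.length_append, hTA]; rfl
      have hA' : ∀ j, j ≤ n + 2 → |w r j| ≤ (getN TA' j : ℝ) * unitP P j := by
        intro j hj
        rcases Nat.lt_or_ge j (n + 2) with hlt | hge
        · rw [hTA', getN_append_left (by rw [hTA]; exact hlt)]; exact hAold j (by omega)
        · have hj' : j = n + 2 := by omega
          subst hj'
          have e := getN_append_single T.1 (stepA P dlo nww nwz T.1 T.2)
          rw [hTA] at e
          rw [hTA', e]; exact hwnew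
      -- the new `Z`-entry
      have hkk' : (kk : ℝ) < (n : ℝ) + 2 := by
        have : ((K : ℕ) : ℝ) ≤ ((n + 2 : ℕ) : ℝ) := by exact_mod_cast (by omega : K ≤ n + 2)
        push_cast at this; linarith
      have hsl' : (dz1 : ℝ) * ((n : ℝ) + 2 - kk) ≤ |slopeZ r (w r) (z r) (n + 2)| := by
        have := hsl (n + 2) (by omega); push_cast at this; exact this
      have hznew : |z r (n + 2)| ≤ (stepB P cw dz1 kk TA' T.2 : ℝ) * unitP P (n + 2) :=
        abs_z_le_stepB hdz hkk' hsl' hcw hTA'len hTB hA' hBold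
      -- read off entry `i`
      have hstruct : majPair P dlo nww nwz cw dz1 kk HA HB (s + 1) = (TA', T.2 ++ [stepB P cw dz1 kk TA' T.2]) := by
        simp only [majPair, ← hT, hTA']
      rw [hstruct]
      refine ⟨hA' i (by omega), ?_⟩
      rcases Nat.lt_or_ge i (n + 2) with hlt | hge
      · rw [getN_append_left (by rw [hTB]; exact hlt)]; exact hBold i (by omega)
      · have hi' : i = n + 2 := by omega
        subst hi'
        have e := getN_append_single T.2 (stepB P cw dz1 kk TA' T.2)
        rw [hTB] at e
        rw [e]; exact hznew

end Sound

end SonicSeries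

end Monatomic

end BuckmasterCaolaboraGomezserrano2025

end Literature.Analysis.FluidPDE
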